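import Summits.CriticalPhenomena.CardyFormulaZ2.Theses.CardyIKTransport
import Literature.Probability.LatticeModels.CornerFugacityMeasure
import Literature.Probability.RandomPlanarGeometry.HexSAWLattice

/-!
# `CornerLineDescent` (route `CardyIKTransport`, stmt-CriticalPhenomena-10964): a quadrant flip
# changes exactly ONE face parity — one plaquette defect is law-local (a single inverted corner
# fugacity), seams are pure gauge

Negative-side support for the crux `CornerLineDescent` (cdisprove unit, cycle 1).  In the route's
i.i.d. gauge `colour(v) = A_{v₀} ⊕ B_{v₁} ⊕ parity(defects in the rectangle between 0 and v)`, toggling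
the defect bit at the grid vertex `f` flips the colours of all cells of the open quadrant above-right
of `f` (`quadFlip f`).  Pathwise this is a macroscopic rewiring; the point of this file is the exact
combinatorial fact that AT THE LEVEL OF FACE PARITIES it is local:

* `isOddFace_quadFlip_iff` — for every colouring `σ` and every vertex `w`, the face `w` is odd for
  `quadFlip f σ` iff (`w = f`) XOR (`w` is odd for `σ`): every face other than `f` meets the quadrant in
  `0`, `2` or `4` cells (`quadInd_face_xor`).
* `oddFaceCount_quadFlip` — on any finite vertex set containing `f` the corner count changes by
  exactly one.
* `isOddFace_halfFlip₀_iff`, `isOddFace_halfFlip₁_iff`, `quadFlip_halfFlip₀`,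
  `isOddFace_quadFlip_halfFlip₀_iff` — half-plane flips preserve every face parity (exact symmetries
  of the corner weight), so the four quadrant flips at `f` agree modulo gauge: the "seam direction"
  of a pathwise coupling is a free choice.

Consequences recorded for the provers (prose): the push-forward of any corner-fugacity Gibbs weight
`t^{#odd faces}` under `quadFlip f` is the same weight with the fugacity INVERTED at the single face
`f`, so the Russo influence `I_f = P[A | d_f = 1] − P[A | d_f = 0]` of one defect bit on any event `A`
equals `Cov_t(1_A, κ_f)/(p(1−p))`, a covariance with the LOCAL parity `κ_f`; "seams" of pathwise
couplings are pure gauge.  Single-bit Russo along the corner line is therefore governed by the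
local-operator response exponent `x` of the corner seed (`Σ_f I_f ≍ δ^{x−2}`; `x = x₄ = 5/4` is the
route's `3/4` wall, a selection rule is needed for `x > 2`).
-/

namespace Summit.CriticalPhenomena.CardyFormulaZ2.Theorems.CornerLineDescent.Negative

open Literature.Probability.LatticeModels

/-- Flip the colours of every cell `c` strictly above-right of the grid vertex `f`
(`f 0 < c 0 ∧ f 1 < c 1`): the pathwise effect of toggling the defect bit at `f` in the route's
i.i.d. gauge (for `f` in the positive quadrant; the other sign cases differ by half-plane flips,
which are plaid/gauge symmetries). [folklore] -/
def quadFlip (f : Site 2) (σ : Site 2 → Bool) : Site 2 → Bool :=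
  fun c => if f 0 < c 0 ∧ f 1 < c 1 then !σ c else σ c

/-- The quadrant indicator as a Boolean. [folklore] -/
def quadInd (f c : Site 2) : Bool := decide (f 0 < c 0 ∧ f 1 < c 1)

/-- `quadFlip` is XOR with the quadrant indicator. [folklore] -/
theorem quadFlip_apply (f : Site 2) (σ : Site 2 → Bool) (c : Site 2) :
    quadFlip f σ c = (quadInd f c ^^ σ c) := by
  unfold quadFlip quadInd
  by_cases h : f 0 < c 0 ∧ f 1 < c 1 <;> simp [h]

/-- Coordinates of the four cells of the face `w`. [folklore] -/
theorem cellFace_coords (w : Site 2) :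
    (w + Pi.single 0 1 : Site 2) 0 = w 0 + 1 ∧ (w + Pi.single 0 1 : Site 2) 1 = w 1 ∧
    (w + Pi.single 1 1 : Site 2) 0 = w 0 ∧ (w + Pi.single 1 1 : Site 2) 1 = w 1 + 1 ∧
    (w + 1 : Site 2) 0 = w 0 + 1 ∧ (w + 1 : Site 2) 1 = w 1 + 1 := by
  refine ⟨?_, ?_, ?_, ?_, ?_, ?_⟩ <;> simp [Pi.add_apply]

/-- The XOR of the quadrant indicator over the four cells of the face `w` is `[w = f]` (in
coordinates): the face `f` meets the quadrant in exactly one cell (`f + 1`), every other face in `0`,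
`2` or `4` cells. [folklore] -/
theorem quadInd_face_xor (f w : Site 2) :
    ((quadInd f w ^^ quadInd f (w + Pi.single 0 1)) ^^
        (quadInd f (w + Pi.single 1 1) ^^ quadInd f (w + 1))) =
      decide (w 0 = f 0 ∧ w 1 = f 1) := by
  obtain ⟨h1, h2, h3, h4, h5, h6⟩ := cellFace_coords w
  simp only [quadInd, h1, h2, h3, h4, h5, h6]
  by_cases a : f 0 < w 0 <;> by_cases a' : f 0 < w 0 + 1 <;>
    by_cases b : f 1 < w 1 <;> by_cases b' : f 1 < w 1 + 1 <;>
    simp only [a, a', b, b', and_self, and_true, and_false, decide_true,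
      decide_false, Bool.xor_true, Bool.xor_false, Bool.not_true, Bool.not_false] <;>
    first
    | (rw [eq_comm, decide_eq_true_iff]; omega)
    | (rw [eq_comm, decide_eq_false_iff_not]; omega)

/-- A QUADRANT FLIP CHANGES EXACTLY ONE FACE PARITY: `w` is an odd face of `quadFlip f σ` iff
(`w = f`) XOR (`w` is an odd face of `σ`).  At the level of the corner-fugacity weight
`t^{#odd faces}` one plaquette defect is therefore the fugacity inverted at the single face `f`; in the
route's gauge the Russo influence of the defect bit `d_f` on any event is a covariance with the local
parity at `f` — there is no seam in law. [folklore] -/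
theorem isOddFace_quadFlip_iff (f : Site 2) (σ : Site 2 → Bool) (w : Site 2) :
    IsOddFace (quadFlip f σ) w ↔ Xor (w = f) (IsOddFace σ w) := by
  rw [isOddFace_iff_xor, isOddFace_iff_xor, quadFlip_apply, quadFlip_apply, quadFlip_apply,
    quadFlip_apply]
  have key := quadInd_face_xor f w
  have regroup : ((quadInd f w ^^ σ w ^^ (quadInd f (w + Pi.single 0 1) ^^ σ (w + Pi.single 0 1))) ^^
      (quadInd f (w + Pi.single 1 1) ^^ σ (w + Pi.single 1 1) ^^
        (quadInd f (w + 1) ^^ σ (w + 1)))) =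
      (((quadInd f w ^^ quadInd f (w + Pi.single 0 1)) ^^
          (quadInd f (w + Pi.single 1 1) ^^ quadInd f (w + 1))) ^^
        ((σ w ^^ σ (w + Pi.single 0 1)) ^^ (σ (w + Pi.single 1 1) ^^ σ (w + 1)))) := by
    generalize quadInd f w = q1
    generalize quadInd f (w + Pi.single 0 1) = q2
    generalize quadInd f (w + Pi.single 1 1) = q3
    generalize quadInd f (w + 1) = q4
    generalize σ w = s1
    generalize σ (w + Pi.single 0 1) = s2
    generalize σ (w + Pi.single 1 1) = s3
    generalize σ (w + 1) = s4
    cases q1 <;> cases q2 <;> cases q3 <;> cases q4 <;> cases s1 <;> cases s2 <;> cases s3 <;>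
      cases s4 <;> rfl
  rw [regroup, key, Literature.Probability.RandomPlanarGeometry.SAW.site_two_eq_iff]
  generalize ((σ w ^^ σ (w + Pi.single 0 1)) ^^ (σ (w + Pi.single 1 1) ^^ σ (w + 1))) = X
  by_cases hw : w 0 = f 0 ∧ w 1 = f 1
  · have hd : decide (w 0 = f 0 ∧ w 1 = f 1) = true := decide_eq_true hw
    rw [hd]
    cases X <;> simp [Xor, hw]
  · have hd : decide (w 0 = f 0 ∧ w 1 = f 1) = false := decide_eq_false hw
    rw [hd]
    cases X <;> simp [Xor, hw]

/-- Corner count under a quadrant flip: on any finite set of vertices `V` containing `f`, the number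
of odd faces changes by exactly one — down if `f` was odd, up if `f` was even.  Hence
`t^{oddFaceCount V (quadFlip f σ)} = t^{oddFaceCount V σ} · t^{∓1}`: the push-forward of the corner
weight is the weight with the fugacity inverted at `f`. [folklore] -/
theorem oddFaceCount_quadFlip {V : Finset (Site 2)} {f : Site 2} (hf : f ∈ V) (σ : Site 2 → Bool) :
    (IsOddFace σ f → oddFaceCount V (quadFlip f σ) + 1 = oddFaceCount V σ) ∧
    (¬ IsOddFace σ f → oddFaceCount V (quadFlip f σ) = oddFaceCount V σ + 1) := by
  classical
  have hfilter : ∀ (P : Site 2 → Prop) [DecidablePred P],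
      (V.filter P).card = ((V.erase f).filter P).card + (if P f then 1 else 0) := by
    intro P _
    have hV : V = insert f (V.erase f) := (Finset.insert_erase hf).symm
    conv_lhs => rw [hV]
    rw [Finset.filter_insert]
    split_ifs with h
    · rw [Finset.card_insert_of_notMem]
      simp
    · simp
  have hsame : ((V.erase f).filter fun v => IsOddFace (quadFlip f σ) v).card =
      ((V.erase f).filter fun v => IsOddFace σ v).card := by
    refine congrArg Finset.card (Finset.filter_congr fun v hv => ?_)
    have hvf : v ≠ f := Finset.ne_of_mem_erase hv
    rw [isOddFace_quadFlip_iff]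
    simp [Xor, hvf]
  have hflipf : IsOddFace (quadFlip f σ) f ↔ ¬ IsOddFace σ f := by
    rw [isOddFace_quadFlip_iff]; simp [Xor]
  unfold oddFaceCount
  rw [hfilter (fun v => IsOddFace (quadFlip f σ) v), hfilter (fun v => IsOddFace σ v), hsame]
  constructor
  · intro hodd
    have h1 : ¬ IsOddFace (quadFlip f σ) f := by rw [hflipf]; exact not_not.mpr hodd
    simp [h1, hodd]
  · intro heven
    have h1 : IsOddFace (quadFlip f σ) f := by rw [hflipf]; exact heven
    simp [h1, heven]

/-! ## Gauge: half-plane flips preserve every face parity, so the four quadrant flips at `f` agree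
## modulo symmetries of the corner weight ("seams can be redrawn") -/

/-- Flip the colours of every cell strictly to the right of the vertical grid line after column `k`
(`k < c 0`): a plaid/gauge transformation (XOR with a column indicator). [folklore] -/
def halfFlip₀ (k : ℤ) (σ : Site 2 → Bool) : Site 2 → Bool :=
  fun c => if k < c 0 then !σ c else σ c

/-- Flip the colours of every cell strictly above the horizontal grid line after row `k`
(`k < c 1`). [folklore] -/
def halfFlip₁ (k : ℤ) (σ : Site 2 → Bool) : Site 2 → Bool :=
  fun c => if k < c 1 then !σ c else σ c

/-- A vertical half-plane flip preserves EVERY face parity (each face meets the half-plane in `0`,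
`2` or `4` cells): it is an exact symmetry of every corner-fugacity weight `t^{#odd faces}`. [folklore] -/
theorem isOddFace_halfFlip₀_iff (k : ℤ) (σ : Site 2 → Bool) (w : Site 2) :
    IsOddFace (halfFlip₀ k σ) w ↔ IsOddFace σ w := by
  obtain ⟨h1, -, h3, -, h5, -⟩ := cellFace_coords w
  rw [isOddFace_iff_xor, isOddFace_iff_xor]
  simp only [halfFlip₀, h1, h3, h5]
  by_cases a : k < w 0 <;> by_cases a' : k < w 0 + 1 <;> simp only [a, a', if_true, if_false] <;>
    cases σ w <;> cases σ (w + Pi.single 0 1) <;> cases σ (w + Pi.single 1 1) <;>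
      cases σ (w + 1) <;> decide

/-- A horizontal half-plane flip preserves EVERY face parity. [folklore] -/
theorem isOddFace_halfFlip₁_iff (k : ℤ) (σ : Site 2 → Bool) (w : Site 2) :
    IsOddFace (halfFlip₁ k σ) w ↔ IsOddFace σ w := by
  obtain ⟨-, h2, -, h4, -, h6⟩ := cellFace_coords w
  rw [isOddFace_iff_xor, isOddFace_iff_xor]
  simp only [halfFlip₁, h2, h4, h6]
  by_cases b : k < w 1 <;> by_cases b' : k < w 1 + 1 <;> simp only [b, b', if_true, if_false] <;>
    cases σ w <;> cases σ (w + Pi.single 0 1) <;> cases σ (w + Pi.single 1 1) <;>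
      cases σ (w + 1) <;> decide

/-- The lower-right quadrant flip at `f` (cells with `f 0 < c 0 ∧ c 1 ≤ f 1`) is the upper-right one
composed with the vertical half-plane flip: `quadFlip f ∘ halfFlip₀ (f 0)` flips exactly the cells
with `f 0 < c 0 ∧ ¬ (f 1 < c 1)`.  With `isOddFace_halfFlip₀_iff` this says the two quadrant flips
change the same single face parity — the choice of quadrant (the "seam direction") is pure gauge. [folklore] -/
theorem quadFlip_halfFlip₀ (f : Site 2) (σ : Site 2 → Bool) (c : Site 2) :
    quadFlip f (halfFlip₀ (f 0) σ) c = (if f 0 < c 0 ∧ ¬ (f 1 < c 1) then !σ c else σ c) := by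
  unfold quadFlip halfFlip₀
  by_cases a : f 0 < c 0 <;> by_cases b : f 1 < c 1 <;> simp [a, b]

/-- Parity bookkeeping for the lower-right quadrant flip: it, too, changes exactly the face `f`. [folklore] -/
theorem isOddFace_quadFlip_halfFlip₀_iff (f : Site 2) (σ : Site 2 → Bool) (w : Site 2) :
    IsOddFace (quadFlip f (halfFlip₀ (f 0) σ)) w ↔ Xor (w = f) (IsOddFace σ w) := by
  rw [isOddFace_quadFlip_iff, isOddFace_halfFlip₀_iff]

end Summit.CriticalPhenomena.CardyFormulaZ2.Theorems.CornerLineDescent.Negative
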